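import Mathlib
import HarnessLib
import Summits.HubbardSuperconductivity.HubbardSuperconductivity.Theorems.KLProgrammeKLRegimeCountertermProfileSymmetry
import Summits.HubbardSuperconductivity.HubbardSuperconductivity.Theorems.KLProgrammeKLRegimeCountertermFlatCutoffGrid

/-!
# Route `KLProgramme` — child `KLRegimeCounterterm` (V9+): the GRID IDENTITY, part B — the G-objects read the local part EXACTLY at
# the lattice angles: `(klFrameExtG L μ f).eval (latticeMomentum L k) = mean f + χ_flat(k)·(f(momentumAngle L k) − mean f)` for every
# `2π`-periodic `D₄`-invariant profile `f`, hence `(klTwoLegPolyG … K n).eval (latticeMomentum L k) = ν_n(K)(momentumAngle L k)` and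
# `(klFrameProjG L μ K).eval (latticeMomentum L k) = K(k_F(momentumAngle L k))` on the flat tube (seat hubbard-kl-k3c3-p3; Δ18 consumer side)

Part A (`…CountertermProfileSymmetry`) proves that the profiles `θ ↦ ν_n(K)(θ)` and `θ ↦ K(k_F(θ))` are `2π`-periodic and
`D₄`-invariant for EVERY `K : TrigPolyC4v` and evaluates such profiles at polar angles of `D₄`-related vectors.  Here:

* the flat cutoff is `1` on the flat tube and `D₄`-invariant on the torus sites; centred momenta of swapped / reflected / negated sites
  (seam cases `2·k_j = L` handled: there the site is FIXED by the reflection);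
* the lattice data `k ↦ mean f + χ_flat(k)·(f(momentumAngle L k) − mean f)` are even, axis- and swap-symmetric
  (`klFrameExtG_data_symm`) ⇒ p1b's grid reading `eval_klFrameExtG_latticeMomentum(_of_flat)` (`…CountertermFlatCutoffGrid`, data
  symmetry as hypotheses, discharged HERE): **`eval_klFrameExtG_latticeMomentum_of_profile(_flat)`**,
  **`eval_klTwoLegPolyG_latticeMomentum(_of_flat)`**, **`eval_klFrameProjG_latticeMomentum(_of_flat)`**.

With `…CountertermGridReading` (grid bound + (E3g) ⇒ every angle) this closes the reading chain of Δ18: child 2 controls the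
POLYNOMIALS `D_n^G(K)` at flat-tube lattice momenta, which ARE the local part at the lattice angles, which bound it everywhere.
Proofs only; nothing is asserted about the Hubbard model.  References: HOME/hubbard-kl-k3c3-p3/DEFECT-ANGULAR.md §4–§5.
-/

noncomputable section

namespace Summit.HubbardSuperconductivity.HubbardSuperconductivity.Theorems.KLRegimeSplit

set_option linter.dupNamespace false -- summit = problem name (single-conjunct summit), D-0017

open Real Set Complex
open Literature.MathematicalPhysics.QuantumLattice Literature.Probability.LatticeModels
open Summit.HubbardSuperconductivity.HubbardSuperconductivity.Theorems.KLProgrammeLegKernels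
open Summit.HubbardSuperconductivity.HubbardSuperconductivity.Theorems.PerturbedFermiCurve

/-! ## §3 The lattice data are `D₄`-symmetric; the grid identity -/

section Grid

variable (L : ℕ) [NeZero L]

/-- The flat cutoff depends on `k` through `torusBand L k` only: swapped site. -/
theorem klFlatCutoff_swap (μ : ℝ) (k : TorusSite 2 L) : klFlatCutoff L μ ![k 1, k 0] = klFlatCutoff L μ k := by
  have hb : torusBand L ![k 1, k 0] = torusBand L k := by
    simp only [torusBand, Fin.sum_univ_two, latticeMomentum, Matrix.cons_val_zero, Matrix.cons_val_one]
    ring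
  simp only [klFlatCutoff, nambuXi, hb]

/-- The flat cutoff at the axis-reflected site. -/
theorem klFlatCutoff_reflect (μ : ℝ) (k : TorusSite 2 L) : klFlatCutoff L μ ![k 0, -k 1] = klFlatCutoff L μ k := by
  have hb : torusBand L ![k 0, -k 1] = torusBand L k := torusBand_reflSite k
  simp only [klFlatCutoff, nambuXi, hb]

/-- The flat cutoff at the negated site. -/
theorem klFlatCutoff_neg (μ : ℝ) (k : TorusSite 2 L) : klFlatCutoff L μ (-k) = klFlatCutoff L μ k := by
  have h1 : -k = rotSite (rotSite k) := by
    ext i; fin_cases i <;> simp [rotSite]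
  have hb : torusBand L (-k) = torusBand L k := by rw [h1, torusBand_rotSite, torusBand_rotSite]
  simp only [klFlatCutoff, nambuXi, hb]

/-- Centred momentum of the swapped site: the swap of the centred momentum (no seam condition). -/
theorem torusCentredMomentum_swap (k : TorusSite 2 L) :
    torusCentredMomentum L ![k 1, k 0] = ![torusCentredMomentum L k 1, torusCentredMomentum L k 0] := by
  rw [torusCentredMomentum_eq_valMinAbs, torusCentredMomentum_eq_valMinAbs]
  ext j; fin_cases j <;> simp

/-- Centred momentum of `(k₀, −k₁)` off the seam `2k₁ = L`. -/
theorem torusCentredMomentum_reflect {k : TorusSite 2 L} (hk : 2 * (k 1).val ≠ L) :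
    torusCentredMomentum L ![k 0, -k 1] = ![torusCentredMomentum L k 0, -torusCentredMomentum L k 1] := by
  rw [torusCentredMomentum_eq_valMinAbs, torusCentredMomentum_eq_valMinAbs]
  ext j; fin_cases j
  · simp
  · simp [ZMod.valMinAbs_neg_of_ne_half hk]

/-- Centred momentum of `(−k₀, k₁)` off the seam `2k₀ = L`. -/
theorem torusCentredMomentum_negReflect {k : TorusSite 2 L} (hk : 2 * (k 0).val ≠ L) :
    torusCentredMomentum L ![-k 0, k 1] = ![-torusCentredMomentum L k 0, torusCentredMomentum L k 1] := by
  rw [torusCentredMomentum_eq_valMinAbs, torusCentredMomentum_eq_valMinAbs]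
  ext j; fin_cases j
  · simp [ZMod.valMinAbs_neg_of_ne_half hk]
  · simp

/-- Centred momentum of `−k` off both seams. -/
theorem torusCentredMomentum_neg {k : TorusSite 2 L} (hk0 : 2 * (k 0).val ≠ L) (hk1 : 2 * (k 1).val ≠ L) :
    torusCentredMomentum L (-k) = -torusCentredMomentum L k := by
  rw [torusCentredMomentum_eq_valMinAbs, torusCentredMomentum_eq_valMinAbs]
  ext j; fin_cases j
  · simp [ZMod.valMinAbs_neg_of_ne_half hk0]
  · simp [ZMod.valMinAbs_neg_of_ne_half hk1]

variable {f : ℝ → ℝ} (hper : Function.Periodic f (2 * π)) (hpi : ∀ θ, f (θ + π) = f θ) (hneg : ∀ θ, f (-θ) = f θ)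
  (hsw : ∀ θ, f (π / 2 - θ) = f θ)

include hper hsw in
/-- The profile at the lattice angle of the swapped site. -/
theorem profile_momentumAngle_swap (k : TorusSite 2 L) : f (momentumAngle L ![k 1, k 0]) = f (momentumAngle L k) := by
  unfold momentumAngle
  rw [torusCentredMomentum_swap]
  exact profile_polarAngle_swap hper hsw _

include hper hneg in
/-- The profile at the lattice angle of the axis-reflected site (seam case `2k₁ = L`: the site is fixed). -/
theorem profile_momentumAngle_reflect (k : TorusSite 2 L) : f (momentumAngle L ![k 0, -k 1]) = f (momentumAngle L k) := by
  by_cases hk : 2 * (k 1).val = L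
  · have hfix : (![k 0, -k 1] : TorusSite 2 L) = k := by
      have hneg1 : -k 1 = k 1 := (ZMod.neg_eq_self_iff (k 1)).mpr (Or.inr hk)
      ext i; fin_cases i <;> simp [hneg1]
    rw [hfix]
  · unfold momentumAngle
    rw [torusCentredMomentum_reflect L hk]
    exact profile_polarAngle_reflect hper hneg _

include hper hpi hneg in
/-- The profile at the lattice angle of the negated site (all four seam cases). -/
theorem profile_momentumAngle_neg (k : TorusSite 2 L) : f (momentumAngle L (-k)) = f (momentumAngle L k) := by
  by_cases h0 : 2 * (k 0).val = L
  · -- `−k₀ = k₀`: `−k` is the axis reflection of `k`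
    have hneg0 : -k 0 = k 0 := (ZMod.neg_eq_self_iff (k 0)).mpr (Or.inr h0)
    have hk : -k = ![k 0, -k 1] := by ext i; fin_cases i <;> simp [hneg0]
    rw [hk]
    exact profile_momentumAngle_reflect L hper hneg k
  · by_cases h1 : 2 * (k 1).val = L
    · have hneg1 : -k 1 = k 1 := (ZMod.neg_eq_self_iff (k 1)).mpr (Or.inr h1)
      have hk : -k = ![-k 0, k 1] := by ext i; fin_cases i <;> simp [hneg1]
      rw [hk]
      unfold momentumAngle
      rw [torusCentredMomentum_negReflect L h0]
      exact profile_polarAngle_negReflect hper hpi hneg _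
    · unfold momentumAngle
      rw [torusCentredMomentum_neg L h0 h1]
      exact profile_polarAngle_neg hper hpi _

include hper hpi hneg hsw in
/-- **The lattice data of the G-extension are `D₄`-symmetric** for a `2π`-periodic `D₄`-invariant profile. -/
theorem klFrameExtG_data_symm (μ : ℝ) :
    let g : TorusSite 2 L → ℝ := fun k => klAngularMean f + klFlatCutoff L μ k * (f (momentumAngle L k) - klAngularMean f)
    (∀ k, g (-k) = g k) ∧ (∀ k, g ![k 0, -k 1] = g k) ∧ (∀ k, g ![k 1, k 0] = g k) := by
  refine ⟨fun k => ?_, fun k => ?_, fun k => ?_⟩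
  · simp only [klFlatCutoff_neg, profile_momentumAngle_neg L hper hpi hneg]
  · simp only [klFlatCutoff_reflect, profile_momentumAngle_reflect L hper hneg]
  · simp only [klFlatCutoff_swap, profile_momentumAngle_swap L hper hsw]

include hper hpi hneg hsw in
/-- **GRID IDENTITY for the G-extension of a `D₄`-invariant periodic profile**: at every lattice momentum
`(klFrameExtG L μ f)(p_k) = mean f + χ_flat(k)·(f(θ_k) − mean f)` (p1b's `eval_klFrameExtG_latticeMomentum` with its data-symmetry
hypotheses discharged by `klFrameExtG_data_symm`). -/
theorem eval_klFrameExtG_latticeMomentum_of_profile (μ : ℝ) (k : TorusSite 2 L) :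
    (klFrameExtG L μ f).eval (latticeMomentum L k) =
      klAngularMean f + klFlatCutoff L μ k * (f (momentumAngle L k) - klAngularMean f) := by
  obtain ⟨h1, h2, h3⟩ := klFrameExtG_data_symm L hper hpi hneg hsw μ
  exact eval_klFrameExtG_latticeMomentum L f h1 h2 h3 k

include hper hpi hneg hsw in
/-- **GRID IDENTITY on the flat tube** for a `D₄`-invariant periodic profile: `(klFrameExtG L μ f)(p_k) = f(θ_k)` when
`|ε(p_k) − μ| ≤ klFlatR`. -/
theorem eval_klFrameExtG_latticeMomentum_of_profile_flat (μ : ℝ) {k : TorusSite 2 L} (hk : |nambuXi L μ k| ≤ klFlatR) :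
    (klFrameExtG L μ f).eval (latticeMomentum L k) = f (momentumAngle L k) := by
  obtain ⟨h1, h2, h3⟩ := klFrameExtG_data_symm L hper hpi hneg hsw μ
  exact eval_klFrameExtG_latticeMomentum_of_flat L f h1 h2 h3 hk

end Grid

section Model

variable (L M : ℕ) [NeZero L] [NeZero M]

/-- **GRID IDENTITY for `D_n^G(K)`**: at every lattice momentum,
`(klTwoLegPolyG … K n)(p_k) = m_n(K) + χ_flat(k)·(ν_n(K)(θ_k) − m_n(K))`, `m_n = klAngularMean ν_n(K)` — for EVERY `K : TrigPolyC4v`. -/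
theorem eval_klTwoLegPolyG_latticeMomentum (β U μ : ℝ) (K : TrigPolyC4v) (n : ℕ) (k : TorusSite 2 L) :
    (klTwoLegPolyG L M β U μ K n).eval (latticeMomentum L k) =
      klAngularMean (klLocalPart L M β U μ K n) +
        klFlatCutoff L μ k * (klLocalPart L M β U μ K n (momentumAngle L k) - klAngularMean (klLocalPart L M β U μ K n)) :=
  eval_klFrameExtG_latticeMomentum_of_profile L (klLocalPart_periodic β U μ K n) (klLocalPart_add_pi β U μ K n)
    (klLocalPart_neg β U μ K n) (klLocalPart_pi_div_two_sub β U μ K n) μ k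

/-- **GRID IDENTITY for `D_n^G(K)` on the flat tube**: `(klTwoLegPolyG … K n)(p_k) = ν_n(K)(θ_k)` for `|ε(p_k) − μ| ≤ klFlatR` — the
polynomial the one-volume construction controls IS the local part at the flat-tube lattice angles. -/
theorem eval_klTwoLegPolyG_latticeMomentum_of_flat (β U μ : ℝ) (K : TrigPolyC4v) (n : ℕ) {k : TorusSite 2 L}
    (hk : |nambuXi L μ k| ≤ klFlatR) :
    (klTwoLegPolyG L M β U μ K n).eval (latticeMomentum L k) = klLocalPart L M β U μ K n (momentumAngle L k) :=
  eval_klFrameExtG_latticeMomentum_of_profile_flat L (klLocalPart_periodic β U μ K n) (klLocalPart_add_pi β U μ K n)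
    (klLocalPart_neg β U μ K n) (klLocalPart_pi_div_two_sub β U μ K n) μ hk

end Model

section Proj

variable (L : ℕ) [NeZero L]

/-- **GRID IDENTITY for the normal form `P^G(K)`**: `(klFrameProjG L μ K)(p_k) = mean(K∘k_F) + χ_flat(k)·(K(k_F(θ_k)) − mean(K∘k_F))`. -/
theorem eval_klFrameProjG_latticeMomentum (μ : ℝ) (K : TrigPolyC4v) (k : TorusSite 2 L) :
    (klFrameProjG L μ K).eval (latticeMomentum L k) =
      klAngularMean (fun θ => K.eval (klFermiPoint μ K θ)) +
        klFlatCutoff L μ k * (K.eval (klFermiPoint μ K (momentumAngle L k)) - klAngularMean (fun θ => K.eval (klFermiPoint μ K θ))) :=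
  eval_klFrameExtG_latticeMomentum_of_profile L (frameOnCurve_periodic μ K) (frameOnCurve_add_pi μ K) (frameOnCurve_neg μ K)
    (frameOnCurve_pi_div_two_sub μ K) μ k

/-- **GRID IDENTITY for `P^G(K)` on the flat tube**: `(klFrameProjG L μ K)(p_k) = K(k_F(θ_k))`. -/
theorem eval_klFrameProjG_latticeMomentum_of_flat (μ : ℝ) (K : TrigPolyC4v) {k : TorusSite 2 L} (hk : |nambuXi L μ k| ≤ klFlatR) :
    (klFrameProjG L μ K).eval (latticeMomentum L k) = K.eval (klFermiPoint μ K (momentumAngle L k)) :=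
  eval_klFrameExtG_latticeMomentum_of_profile_flat L (frameOnCurve_periodic μ K) (frameOnCurve_add_pi μ K) (frameOnCurve_neg μ K)
    (frameOnCurve_pi_div_two_sub μ K) μ hk

end Proj

end Summit.HubbardSuperconductivity.HubbardSuperconductivity.Theorems.KLRegimeSplit

end
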